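import Summits.Ventures.PercRepro.S4MaxFlatEightReduction
import Summits.Ventures.PercRepro.S4MaxFlatSplit
import Summits.Ventures.PercRepro.S4UpsCellP10D15A

/-!
# PercRepro — THE LEVEL-7 CELL `(10, 15)` FOR THE `e`-FREE CORE: RANK `10` ON `25` POINTS (p7 g23, S4 feeder; p8's statement shape)

`5/2 · #U(10, 7) ≤ #Y(10, 7)` on every simple coloop-free matroid of rank `10` on `25` points with the e-free flat bounds,
by the split on a rank-`8` set with `22` points: the reduction to C-025 at `(8, 6)` on the flat (`s7lp_10_of_maxflat8'`), else the LP cell with the rank-`8` bound `21`. Nothing else is claimed.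

* **`s7lp_10_25`**.
Axioms: standard.
-/

open scoped Matroid

namespace PercRepro

namespace S3LP

open Set Finset S2LP S4Ups

variable {α : Type}

/-- **THE LEVEL-7 CELL `(10, 15)`**: rank `10` on `25` points, constant `5/2`. -/
theorem s7lp_10_25 (M : Matroid α) [M.Finite] (hM : M.eRank = ((10 : ℕ) : ℕ∞))
    (hE : M.E.ncard = 25) (hcol : M.coloops = ∅) (hpairs : ∀ e ∈ M.E, ∀ f ∈ M.E, e ≠ f → M.eRk {e, f} = 2)
    (hlines : ∀ L ⊆ M.E, M.eRk L = 2 → L.ncard ≤ 3) (hplanes : ∀ P ⊆ M.E, M.eRk P ≤ 3 → P.ncard ≤ 6)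
    (htens : ∀ X ⊆ M.E, M.eRk X ≤ 4 → X.ncard ≤ 10) (hnineteen : ∀ X ⊆ M.E, M.eRk X ≤ 5 → X.ncard ≤ 19) :
    (5 / 2 : ℚ) * (Matroid.topCount M 10 7 : ℚ) ≤ (Matroid.midCount M 10 7 : ℚ) := by
  by_cases h : ∃ F ⊆ M.E, M.eRk F = ((8 : ℕ) : ℕ∞) ∧ F.ncard + 3 = M.E.ncard
  · obtain ⟨F, hF, hFr, hFn⟩ := h
    exact s7lp_10_of_maxflat8' hM hcol hF hFr hFn
  · exact s7lp_10_25_of_flat8_21 M hM hE hcol hpairs hlines hplanes htens hnineteen (eight_le_of_no_maxflat_ten hM hE hcol h)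

end S3LP

end PercRepro
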